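import Literature.NumberTheory.Automorphic.BrandtModule
import Literature.NumberTheory.Automorphic.QuaternionOrderIntegral
import Mathlib.Data.ZMod.Units
import Mathlib.Tactic.Module
import HarnessLib

/-!
# Eichler orders of level `N` from local data: localisation of `ℤ`-lattices at a prime,
# local maximality, and the order `O₂` with `O₂,p = u_p O₁,p u_p⁻¹` (`p ∣ N`), `O₂,q = O₁,q`
# (Vignéras, LNM 800, Ch. III §5 Prop. 5.1 and the "propriétés locales" (1)–(3); Ch. II §2)

Topic `NumberTheory/Automorphic`. Second brick of the proof of the named fact
`nonempty_eichlerPackage` of `Literature/NumberTheory/Automorphic/BrandtModule.lean` (existence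
of an Eichler order of level `N⁺` in the definite quaternion algebra of discriminant `N⁻`),
following Vignéras' local–global architecture, but with the *localisations*
`L_(p) = ℤ_(p) L ∩ B` of a `ℤ`-lattice `L ⊆ B` (inside `B`, no completion) in place of the
completions `L_p`:

> **III §5 Prop. 5.1.** `Y ↦ (Y_p)_p` is a bijection between lattices of `H` and coherent families
> of local lattices, with inverse `(Y_p) ↦ {x ∈ H, x ∈ Y_p ∀ p}`; being an order, a maximal
> order, an Eichler order (the intersection of two maximal orders) are *local properties*.
> **II §2.** Over a local ring the Eichler order of level `p^n` is
> `M(2, R) ∩ g M(2, R) g⁻¹ = (R R; p^n R R)`, `g = diag(1, p^n)`, of index `p^n` in `M(2, R)`.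

## Contents (all proved; two definitions with bodies, no named fact)

* `localizedAt p L` — the **localisation at `p`** of a `ℤ`-submodule `L ⊆ B`:
  `{x ∈ B | s x ∈ L for some s ∈ ℤ coprime to p}` (`= ℤ_(p) L` inside `B`); monotone, idempotent,
  multiplicatively closed when `L` is; `mem_of_forall_prime_mem_localizedAt` — **`L = ⋂_p L_(p)`**
  (Prop. 5.1, injectivity); `mem_of_smul_mem_of_isCoprime` (two coprime denominators);
  `exists_pow_smul_mem_localizedAt` (a full lattice absorbs everything up to a power of `p`,
  locally at `p`).
* `unitsConj u` — conjugation `x ↦ u x u⁻¹` by a unit, as a `ℤ`-linear automorphism of `B`;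
  orders and maximal orders are stable under it (`IsZOrder.map_unitsConj`,
  `IsMaximalZOrder.map_unitsConj`), and it commutes with localisation.
* `IsMaximalZOrder.localizedAt_eq_of_le` — **a maximal order is locally maximal**: if `O₁` is a
  maximal `ℤ`-order and `O'` a `ℤ`-order with `O₁,(p) ⊆ O'_(p)` then `O'_(p) = O₁,(p)` (patch the
  order `{y ∈ O'_(p) : p^e y ∈ O₁}`, which contains `O₁`; Prop. 5.1 surjectivity + local
  property (2)).
* `eichlerConj O₁ N u` — for a maximal order `O₁`, `N ≥ 1` and units `u_p` (`p ∣ N`), **the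
  lattice `O₂` with `O₂,(p) = (u_p O₁ u_p⁻¹)_(p)` for `p ∣ N` and `O₂,(q) = O₁,(q)` for `q ∤ N`**:
  `{x | N^k x ∈ O₁ for some k, and x ∈ (u_p O₁ u_p⁻¹)_(p) for all p ∣ N}`. It is a `ℤ`-order
  (`isZOrder_eichlerConj`), with the said localisations (`localizedAt_eichlerConj_of_dvd`,
  `localizedAt_eichlerConj_of_not_dvd`), and **maximal** (`isMaximalZOrder_eichlerConj`: an order
  above it is locally everywhere equal to it by `localizedAt_eq_of_le`, hence equal to it by
  `L = ⋂_p L_(p)`) — local property (2) read backwards.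
* `relIndex_inf_eichlerConj` — **the index `[O₁ : O₁ ∩ O₂] = N`** as soon as, for each
  `p ∣ N`, `O₁ ∩ (u_p O₁ u_p⁻¹)_(p)` is the kernel of a surjective additive map
  `O₁ → ℤ/p^{v_p(N)}` (Chinese remainder theorem); `exists_unitsConj_kernel_of_modPow` — such a
  `u_p` and such a map come from any surjective "reduction mod `p^k`" ring homomorphism
  `ψ : O₁ → M₂(ℤ/p^k)` with kernel `p^k O₁` (`k > n = v_p(N)`): `u_p = ψ⁻¹ diag(1, p^n)`, the map
  is `x ↦ ψ(x)₂₁ mod p^n`, and `O₁ ∩ u_p O₁,(p) u_p⁻¹ = {x : ψ(x)₂₁ ≡ 0 mod p^n}` is Vignéras'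
  `(R R; p^n R R)` (II §2) — here `p^n ∈ u_p O₁,(p)` is obtained from `u u' = p^n (1 + p w)`
  (`u' = ψ⁻¹ diag(p^n, 1)`) and `(1 + p w)(1 + p (t - w)) = 1 + p t + p² n₀` for `w` in the order
  (`w² = t w - n₀`, Vignéras I §1), an element of `ℤ` prime to `p`.
* `exists_isEichlerOrder_of_modPow` — **assembly**: a maximal order `O₁` of a division
  quaternion algebra over `ℚ` admitting such reductions `ψ_p` for all `p ∣ N` contains an
  Eichler order `O₁ ∩ O₂` of level `N` (`IsEichlerOrder`, `BrandtModule.lean`).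

The reductions `ψ_p` themselves (from the splitting `B ⊗ ℚ_p ≅ M₂(ℚ_p)` at `p ∤ disc B` and the
maximality of `O₁`, Vignéras II §2 Thm. 2.3 (1)) are constructed in the sibling file
`EichlerOrderPadicSplitting.lean`.

## References

* M.-F. Vignéras, *Arithmétique des algèbres de quaternions*, LNM 800 (1980), Ch. I §1 and §4,
  Ch. II §2 (ordres d'Eichler de niveau `p^n`, Lemme 2.4), Ch. III §5 Prop. 5.1 and the list of
  "propriétés locales" following it [VignerasLNM800].
-/

noncomputable section

open scoped Pointwise

namespace Literature.NumberTheory.Automorphic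

/-! ### Localisation of a `ℤ`-lattice at a prime, inside `B` -/

section Localization

variable {B : Type*} [Ring B]

/-- The **localisation at `p`** of a `ℤ`-submodule `L ⊆ B`, inside `B`:
`L_(p) = {x ∈ B | s • x ∈ L for some integer s coprime to p}` — the trace on `B` of the
`ℤ_(p)`-module `ℤ_(p) ⊗ L` (Vignéras III §5 works with the completions `R_p ⊗ L`; for the
local–global statements used here the localisations suffice and stay inside `B`). [cite: VignerasLNM800, Ch. III §5 A (localisé d'un réseau)] -/
def localizedAt (p : ℕ) (L : Submodule ℤ B) : Submodule ℤ B where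
  carrier := {x | ∃ s : ℤ, IsCoprime (p : ℤ) s ∧ s • x ∈ L}
  add_mem' := by
    rintro a b ⟨s, hs, hsa⟩ ⟨t, ht, htb⟩
    refine ⟨s * t, hs.mul_right ht, ?_⟩
    rw [smul_add, mul_comm s t, mul_smul, mul_smul, smul_comm t s b]
    exact L.add_mem (L.smul_mem t hsa) (L.smul_mem s htb)
  zero_mem' := ⟨1, isCoprime_one_right, by rw [smul_zero]; exact L.zero_mem⟩
  smul_mem' := by
    rintro n x ⟨s, hs, hsx⟩
    exact ⟨s, hs, by rw [smul_comm]; exact L.smul_mem n hsx⟩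

variable {p : ℕ} {L M : Submodule ℤ B}

/-- Membership in the localisation (definitional). [folklore] -/
theorem mem_localizedAt_iff {x : B} :
    x ∈ localizedAt p L ↔ ∃ s : ℤ, IsCoprime (p : ℤ) s ∧ s • x ∈ L := Iff.rfl

/-- `L ⊆ L_(p)`. [folklore] -/
theorem le_localizedAt (L : Submodule ℤ B) : L ≤ localizedAt p L :=
  fun _ hx => ⟨1, isCoprime_one_right, by rwa [one_smul]⟩

/-- Localisation is monotone. [folklore] -/
theorem localizedAt_mono (h : L ≤ M) : localizedAt p L ≤ localizedAt p M :=
  fun _ ⟨s, hs, hsx⟩ => ⟨s, hs, h hsx⟩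

/-- If `s • x ∈ L_(p)` with `s` coprime to `p` then `x ∈ L_(p)`. [folklore] -/
theorem mem_localizedAt_of_smul_mem {s : ℤ} (hs : IsCoprime (p : ℤ) s) {x : B}
    (hx : s • x ∈ localizedAt p L) : x ∈ localizedAt p L := by
  obtain ⟨t, ht, htx⟩ := hx
  exact ⟨t * s, ht.mul_right hs, by rwa [mul_smul]⟩

/-- Localisation is idempotent. [folklore] -/
theorem localizedAt_localizedAt : localizedAt p (localizedAt p L) = localizedAt p L :=
  le_antisymm (fun _ ⟨_, hs, hsx⟩ => mem_localizedAt_of_smul_mem hs hsx) (le_localizedAt _)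

/-- `L_(p) ⊆ M_(p)` as soon as `L ⊆ M_(p)`. [folklore] -/
theorem localizedAt_le_localizedAt_of_le (h : L ≤ localizedAt p M) :
    localizedAt p L ≤ localizedAt p M := by
  rw [← localizedAt_localizedAt (L := M)]
  exact localizedAt_mono h

/-- The localisation of a multiplicatively closed lattice is multiplicatively closed. [folklore] -/
theorem mul_mem_localizedAt (hmul : ∀ a ∈ L, ∀ b ∈ L, a * b ∈ L) {x y : B}
    (hx : x ∈ localizedAt p L) (hy : y ∈ localizedAt p L) : x * y ∈ localizedAt p L := by
  obtain ⟨s, hs, hsx⟩ := hx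
  obtain ⟨t, ht, hty⟩ := hy
  refine ⟨s * t, hs.mul_right ht, ?_⟩
  rw [← smul_mul_smul_comm]
  exact hmul _ hsx _ hty

/-- **Two coprime denominators**: if `s • x ∈ L` and `t • x ∈ L` with `s, t` coprime then
`x ∈ L` (Bézout). [folklore] -/
theorem mem_of_smul_mem_of_isCoprime {s t : ℤ} (h : IsCoprime s t) {x : B} (hs : s • x ∈ L)
    (ht : t • x ∈ L) : x ∈ L := by
  obtain ⟨a, b, hab⟩ := h
  have hx : x = a • s • x + b • t • x := by
    rw [smul_smul, smul_smul, ← add_smul, hab, one_smul]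
  rw [hx]
  exact L.add_mem (L.smul_mem a hs) (L.smul_mem b ht)

/-- **`L = ⋂_p L_(p)`** (Vignéras III §5 Prop. 5.1, injectivity of `Y ↦ (Y_p)`): an element
lying in every localisation of `L` lies in `L` (the ideal of its denominators is contained in no
prime ideal of `ℤ`). [cite: VignerasLNM800, Ch. III §5 Prop. 5.1] -/
theorem mem_of_forall_prime_mem_localizedAt {x : B}
    (h : ∀ p : ℕ, p.Prime → x ∈ localizedAt p L) : x ∈ L := by
  let I : Ideal ℤ := L.comap (LinearMap.toSpanSingleton ℤ B x)
  have hI : ∀ n : ℤ, n ∈ I ↔ n • x ∈ L := fun n => by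
    simp only [I, Submodule.mem_comap, LinearMap.toSpanSingleton_apply]
  set g := Submodule.IsPrincipal.generator I with hg
  have hIg : I = Ideal.span {g} := (Submodule.IsPrincipal.span_singleton_generator I).symm
  suffices hu : IsUnit g by
    have h1 : (1 : ℤ) ∈ I := by
      rw [hIg, Ideal.span_singleton_eq_top.mpr hu]
      exact Submodule.mem_top
    rw [hI, one_smul] at h1
    exact h1
  by_contra hgu
  have hg1 : g.natAbs ≠ 1 := fun h1 => hgu (Int.isUnit_iff_natAbs_eq.mpr h1)
  obtain ⟨p, hp, hpg⟩ := Nat.exists_prime_and_dvd hg1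
  obtain ⟨s, hs, hsx⟩ := h p hp
  have hsI : s ∈ I := (hI s).mpr hsx
  rw [hIg, Ideal.mem_span_singleton] at hsI
  have hps : (p : ℤ) ∣ s := (Int.natCast_dvd.mpr hpg).trans hsI
  have hu : IsUnit (p : ℤ) := hs.isUnit_of_dvd' (dvd_refl _) hps
  exact hp.ne_one (by simpa using Int.isUnit_iff_natAbs_eq.mp hu)

/-- Decomposition of a non-zero integer as (coprime-to-`p` part) × (power of `p`). [folklore] -/
theorem exists_isCoprime_mul_pow_eq (hp : p.Prime) {n : ℤ} (hn : n ≠ 0) :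
    ∃ e : ℕ, ∃ s : ℤ, IsCoprime (p : ℤ) s ∧ s * (p : ℤ) ^ e = n := by
  obtain ⟨e, m, hm, hnm⟩ :=
    Nat.exists_eq_pow_mul_and_not_dvd (Int.natAbs_ne_zero.mpr hn) p hp.ne_one
  refine ⟨e, n.sign * m, ?_, ?_⟩
  · rw [Int.isCoprime_iff_gcd_eq_one, Int.gcd_eq_natAbs, Int.natAbs_mul,
      Int.natAbs_sign_of_ne_zero hn, one_mul, Int.natAbs_natCast, Int.natAbs_natCast]
    exact hp.coprime_iff_not_dvd.mpr hm
  · calc n.sign * m * (p : ℤ) ^ e = n.sign * ((p ^ e * m : ℕ) : ℤ) := by push_cast; ring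
      _ = n := by rw [← hnm, Int.sign_mul_natAbs]

/-- **A full lattice absorbs every element, locally at `p`, after multiplication by a power of
`p`.** [folklore] -/
theorem exists_pow_smul_mem_localizedAt (hp : p.Prime) (hL : IsFullLattice B L) (x : B) :
    ∃ e : ℕ, ((p : ℤ) ^ e) • x ∈ localizedAt p L := by
  obtain ⟨n, hn, hnx⟩ := hL.2 x
  obtain ⟨e, s, hs, rfl⟩ := exists_isCoprime_mul_pow_eq hp hn
  exact ⟨e, s, hs, by rwa [smul_smul]⟩

/-- Uniform version for a finitely generated `M`: `p^e • M ⊆ L_(p)` for some `e`. [folklore] -/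
theorem exists_pow_smul_mem_localizedAt_of_fg (hp : p.Prime) (hL : IsFullLattice B L)
    (hM : M.FG) : ∃ e : ℕ, ∀ x ∈ M, ((p : ℤ) ^ e) • x ∈ localizedAt p L := by
  obtain ⟨n, hn, hnM⟩ := exists_smul_mem_of_fg hL hM
  obtain ⟨e, s, hs, rfl⟩ := exists_isCoprime_mul_pow_eq hp hn
  exact ⟨e, fun x hx => ⟨s, hs, by rw [smul_smul]; exact hnM x hx⟩⟩

/-- If `m • x ∈ L` with `m` coprime to `p` (e.g. a power of another prime) then `x ∈ L_(p)`.
[folklore] -/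
theorem mem_localizedAt_of_coprime_smul_mem {m : ℤ} (hm : IsCoprime (p : ℤ) m) {x : B}
    (hx : m • x ∈ L) : x ∈ localizedAt p L :=
  ⟨m, hm, hx⟩

end Localization

/-! ### Conjugation by a unit -/

section Conj

variable {B : Type*} [Ring B]

/-- Conjugation `x ↦ u x u⁻¹` by a unit `u ∈ Bˣ`, as a `ℤ`-linear automorphism of `B` (so that
`L.map (unitsConj u)` is the lattice `u L u⁻¹`). [folklore] -/
def unitsConj (u : Bˣ) : B ≃ₗ[ℤ] B where
  toFun x := u * x * ↑u⁻¹
  invFun x := ↑u⁻¹ * x * u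
  map_add' x y := by rw [mul_add, add_mul]
  map_smul' n x := by rw [mul_smul_comm, smul_mul_assoc, RingHom.id_apply]
  left_inv x := by
    simp only [← mul_assoc, Units.inv_mul, one_mul, Units.inv_mul_cancel_right]
  right_inv x := by
    simp only [← mul_assoc, Units.mul_inv, one_mul, Units.mul_inv_cancel_right]

/-- `unitsConj u x = u x u⁻¹` (definitional). [folklore] -/
@[simp] theorem unitsConj_apply (u : Bˣ) (x : B) : unitsConj u x = u * x * ↑u⁻¹ := rfl

/-- `(unitsConj u)⁻¹ x = u⁻¹ x u` (definitional). [folklore] -/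
@[simp] theorem unitsConj_symm_apply (u : Bˣ) (x : B) : (unitsConj u).symm x = ↑u⁻¹ * x * u :=
  rfl

/-- `x ∈ u L u⁻¹ ↔ u⁻¹ x u ∈ L`. [folklore] -/
theorem mem_map_unitsConj_iff (u : Bˣ) (L : Submodule ℤ B) (x : B) :
    x ∈ L.map (unitsConj u : B →ₗ[ℤ] B) ↔ ↑u⁻¹ * x * u ∈ L := by
  rw [← unitsConj_symm_apply]
  exact Submodule.mem_map_equiv (e := unitsConj u) (p := L)

/-- `u⁻¹ (u L u⁻¹) u = L`. [folklore] -/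
theorem map_unitsConj_inv_map_unitsConj (u : Bˣ) (L : Submodule ℤ B) :
    (L.map (unitsConj u : B →ₗ[ℤ] B)).map (unitsConj u⁻¹ : B →ₗ[ℤ] B) = L := by
  ext x
  rw [mem_map_unitsConj_iff, mem_map_unitsConj_iff, inv_inv]
  simp only [← mul_assoc, Units.inv_mul, one_mul, Units.inv_mul_cancel_right]

/-- Conjugates of full lattices are full lattices. [folklore] -/
theorem IsFullLattice.map_unitsConj (u : Bˣ) {L : Submodule ℤ B} (hL : IsFullLattice B L) :
    IsFullLattice B (L.map (unitsConj u : B →ₗ[ℤ] B)) := by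
  refine ⟨hL.1.map _, fun d => ?_⟩
  obtain ⟨n, hn, hnd⟩ := hL.2 (↑u⁻¹ * d * u)
  refine ⟨n, hn, ?_⟩
  rw [mem_map_unitsConj_iff, mul_smul_comm, smul_mul_assoc]
  exact hnd

/-- **Conjugates of orders are orders.** [folklore] -/
theorem IsZOrder.map_unitsConj (u : Bˣ) {O : Submodule ℤ B} (hO : IsZOrder O) :
    IsZOrder (O.map (unitsConj u : B →ₗ[ℤ] B)) where
  one_mem := by
    rw [mem_map_unitsConj_iff, mul_one, Units.inv_mul]
    exact hO.one_mem
  mul_mem a ha b hb := by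
    rw [mem_map_unitsConj_iff] at ha hb ⊢
    have h := hO.mul_mem _ ha _ hb
    simpa only [mul_assoc, Units.mul_inv_cancel_left] using h
  isFullLattice := hO.isFullLattice.map_unitsConj u

/-- **Conjugates of maximal orders are maximal orders.** [folklore] -/
theorem IsMaximalZOrder.map_unitsConj (u : Bˣ) {O : Submodule ℤ B} (hO : IsMaximalZOrder O) :
    IsMaximalZOrder (O.map (unitsConj u : B →ₗ[ℤ] B)) := by
  refine ⟨hO.1.map_unitsConj u, fun O' hO' hle => ?_⟩
  have hle' : O ≤ O'.map (unitsConj u⁻¹ : B →ₗ[ℤ] B) := by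
    rw [← map_unitsConj_inv_map_unitsConj u O]
    exact Submodule.map_mono hle
  have heq := hO.2 _ (hO'.map_unitsConj u⁻¹) hle'
  have := congrArg (Submodule.map (unitsConj u⁻¹⁻¹ : B →ₗ[ℤ] B)) heq
  rwa [map_unitsConj_inv_map_unitsConj, inv_inv] at this

/-- Localisation commutes with conjugation: `(u L u⁻¹)_(p) = u L_(p) u⁻¹`. [folklore] -/
theorem localizedAt_map_unitsConj (p : ℕ) (u : Bˣ) (L : Submodule ℤ B) :
    localizedAt p (L.map (unitsConj u : B →ₗ[ℤ] B)) =
      (localizedAt p L).map (unitsConj u : B →ₗ[ℤ] B) := by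
  ext x
  simp only [mem_localizedAt_iff, mem_map_unitsConj_iff, mul_smul_comm, smul_mul_assoc]

end Conj

/-! ### A maximal order is locally maximal -/

section LocallyMaximal

variable {B : Type*} [Ring B] [Algebra ℚ B]

/-- A lattice `M` with `m • M ⊆ O` (`m ≠ 0`) is finitely generated when `O` is (it lies in the
image of `O` under `y ↦ m⁻¹ y`). [folklore] -/
theorem fg_of_smul_mem {O : Submodule ℤ B} (hO : O.FG) {m : ℤ} (hm : m ≠ 0)
    {M : Submodule ℤ B} (hM : ∀ y ∈ M, m • y ∈ O) : M.FG := by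
  have hm0 : (m : ℚ) ≠ 0 := Int.cast_ne_zero.mpr hm
  let f : B →ₗ[ℤ] B := DistribSMul.toLinearMap ℤ B ((m : ℚ)⁻¹)
  refine Submodule.FG.of_le (hO.map f) fun y hy => ?_
  refine ⟨m • y, hM y hy, ?_⟩
  change ((m : ℚ)⁻¹) • (m • y) = y
  rw [← Int.cast_smul_eq_zsmul ℚ, smul_smul, inv_mul_cancel₀ hm0, one_smul]

/-- **A maximal `ℤ`-order is locally maximal** (Vignéras III §5: being a maximal order is a
local property — the direction "global maximal ⇒ locally maximal", proved by patching,
Prop. 5.1): if `O₁` is a maximal `ℤ`-order, `O'` any `ℤ`-order and `O₁,(p) ⊆ O'_(p)`, then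
`O'_(p) = O₁,(p)`. Indeed `M = {y ∈ O'_(p) | p^e y ∈ O₁ for some e}` is a `ℤ`-order containing
`O₁`, hence equal to it, and every element of `O'_(p)` has a prime-to-`p` multiple in `M`. [cite: VignerasLNM800, Ch. III §5 Prop. 5.1 and propriété locale (2)] -/
theorem IsMaximalZOrder.localizedAt_eq_of_le {O₁ O' : Submodule ℤ B} (hO₁ : IsMaximalZOrder O₁)
    {p : ℕ} (hp : p.Prime) (hO' : IsZOrder O') (h : localizedAt p O₁ ≤ localizedAt p O') :
    localizedAt p O' = localizedAt p O₁ := by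
  refine le_antisymm ?_ h
  obtain ⟨c, hc⟩ :=
    exists_pow_smul_mem_localizedAt_of_fg hp hO₁.1.isFullLattice hO'.isFullLattice.1
  -- the patched order
  let M : Submodule ℤ B :=
    { carrier := {y | y ∈ localizedAt p O' ∧ ∃ e : ℕ, ((p : ℤ) ^ e) • y ∈ O₁}
      add_mem' := by
        rintro a b ⟨ha, e, hea⟩ ⟨hb, f, hfb⟩
        refine ⟨Submodule.add_mem _ ha hb, e + f, ?_⟩
        rw [smul_add]
        refine O₁.add_mem ?_ ?_
        · rw [pow_add, mul_comm, mul_smul]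
          exact O₁.smul_mem _ hea
        · rw [pow_add, mul_smul]
          exact O₁.smul_mem _ hfb
      zero_mem' := ⟨Submodule.zero_mem _, 0, by rw [smul_zero]; exact O₁.zero_mem⟩
      smul_mem' := by
        rintro n y ⟨hy, e, hey⟩
        exact ⟨Submodule.smul_mem _ n hy, e, by rw [smul_comm]; exact O₁.smul_mem n hey⟩ }
  have hMmem : ∀ y : B, y ∈ M ↔ y ∈ localizedAt p O' ∧ ∃ e : ℕ, ((p : ℤ) ^ e) • y ∈ O₁ :=
    fun y => Iff.rfl
  -- `M ⊆ {y | p^c y ∈ O₁}`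
  have hMc : ∀ y ∈ M, ((p : ℤ) ^ c) • y ∈ O₁ := by
    rintro y ⟨⟨t, ht, hty⟩, e, hey⟩
    have h1 : ((p : ℤ) ^ c) • y ∈ localizedAt p O₁ := by
      refine mem_localizedAt_of_smul_mem ht ?_
      rw [smul_comm]
      exact hc _ hty
    obtain ⟨t', ht', ht'y⟩ := h1
    refine mem_of_smul_mem_of_isCoprime (IsCoprime.pow_left (m := e) ht').symm ht'y ?_
    rw [smul_comm]
    exact O₁.smul_mem _ hey
  have hM : IsZOrder M :=
    { one_mem := ⟨le_localizedAt _ hO'.one_mem, 0, by rw [pow_zero, one_smul]; exact hO₁.1.one_mem⟩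
      mul_mem := by
        rintro a ⟨ha, e, hea⟩ b ⟨hb, f, hfb⟩
        refine ⟨mul_mem_localizedAt hO'.mul_mem ha hb, e + f, ?_⟩
        rw [pow_add, ← smul_mul_smul_comm]
        exact hO₁.1.mul_mem _ hea _ hfb
      isFullLattice := by
        refine ⟨fg_of_smul_mem hO₁.1.isFullLattice.1
          (pow_ne_zero c (Nat.cast_ne_zero.mpr hp.ne_zero)) hMc, fun d => ?_⟩
        obtain ⟨n, hn, hnd⟩ := hO₁.1.isFullLattice.2 d
        exact ⟨n, hn, h (le_localizedAt _ hnd), 0, by rw [pow_zero, one_smul]; exact hnd⟩ }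
  have hle : O₁ ≤ M := fun y hy =>
    ⟨h (le_localizedAt _ hy), 0, by rw [pow_zero, one_smul]; exact hy⟩
  have hMeq : M = O₁ := hO₁.2 M hM hle
  intro y hy
  obtain ⟨n, hn, hny⟩ := hO₁.1.isFullLattice.2 y
  obtain ⟨e, s, hs, rfl⟩ := exists_isCoprime_mul_pow_eq hp hn
  have hsyM : s • y ∈ M := by
    refine ⟨Submodule.smul_mem _ s hy, e, ?_⟩
    rw [smul_smul, mul_comm]
    exact hny
  rw [hMeq] at hsyM
  exact ⟨s, hs, hsyM⟩

end LocallyMaximal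

/-! ### The order `O₂` with prescribed localisations -/

section EichlerConj

variable {B : Type*} [Ring B]

/-- **The lattice `O₂` attached to a `ℤ`-order `O₁`, a level `N` and units `u_p` (`p ∣ N`)**:
`O₂ = {x ∈ B | N^k x ∈ O₁ for some k, and x ∈ (u_p O₁ u_p⁻¹)_(p) for every prime p ∣ N}` —
the global lattice with localisations `(u_p O₁ u_p⁻¹)_(p)` at `p ∣ N` and `O₁,(q)` at `q ∤ N`
(Vignéras III §5 Prop. 5.1, the inverse map `(Y_p) ↦ {x ∈ H, x ∈ Y_p ∀ p}`; with
`u_p = diag(1, p^n)` locally this is the second maximal order `(R p^{-n}R; p^n R R)` of the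
Eichler order of level `p^n`, II §2). [cite: VignerasLNM800, Ch. III §5 Prop. 5.1, Ch. II §2 (ordre d'Eichler de niveau p^n)] -/
def eichlerConj (O₁ : Submodule ℤ B) (N : ℕ) (u : ℕ → Bˣ) : Submodule ℤ B where
  carrier := {x | (∃ k : ℕ, ((N : ℤ) ^ k) • x ∈ O₁) ∧
    ∀ p ∈ N.primeFactors, x ∈ localizedAt p (O₁.map (unitsConj (u p) : B →ₗ[ℤ] B))}
  add_mem' := by
    rintro a b ⟨⟨k, hka⟩, ha⟩ ⟨⟨l, hlb⟩, hb⟩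
    refine ⟨⟨k + l, ?_⟩, fun p hp => Submodule.add_mem _ (ha p hp) (hb p hp)⟩
    rw [smul_add]
    refine O₁.add_mem ?_ ?_
    · rw [pow_add, mul_comm, mul_smul]
      exact O₁.smul_mem _ hka
    · rw [pow_add, mul_smul]
      exact O₁.smul_mem _ hlb
  zero_mem' := ⟨⟨0, by rw [smul_zero]; exact O₁.zero_mem⟩, fun p _ => Submodule.zero_mem _⟩
  smul_mem' := by
    rintro n x ⟨⟨k, hkx⟩, hx⟩
    exact ⟨⟨k, by rw [smul_comm]; exact O₁.smul_mem n hkx⟩,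
      fun p hp => Submodule.smul_mem _ n (hx p hp)⟩

variable {O₁ : Submodule ℤ B} {N : ℕ} {u : ℕ → Bˣ}

/-- Membership in `eichlerConj O₁ N u` (definitional). [folklore] -/
theorem mem_eichlerConj_iff {x : B} :
    x ∈ eichlerConj O₁ N u ↔ (∃ k : ℕ, ((N : ℤ) ^ k) • x ∈ O₁) ∧
      ∀ p ∈ N.primeFactors, x ∈ localizedAt p (O₁.map (unitsConj (u p) : B →ₗ[ℤ] B)) :=
  Iff.rfl

/-- A prime not dividing `N` is coprime to every power of `N` (in `ℤ`). [folklore] -/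
theorem isCoprime_pow_of_not_dvd {q : ℕ} (hq : q.Prime) (hqN : ¬ q ∣ N) (k : ℕ) :
    IsCoprime (q : ℤ) ((N : ℤ) ^ k) :=
  (Nat.isCoprime_iff_coprime.mpr ((Nat.Prime.coprime_iff_not_dvd hq).mpr hqN)).pow_right

/-- `N^a O₁ ⊆ O₂` for a suitable `a`. [folklore] -/
theorem exists_pow_smul_mem_eichlerConj (hO₁ : IsZOrder O₁) :
    ∃ a : ℕ, ∀ y ∈ O₁, ((N : ℤ) ^ a) • y ∈ eichlerConj O₁ N u := by
  classical
  have key : ∀ p ∈ N.primeFactors, ∃ a : ℕ, ∀ y ∈ O₁,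
      ((p : ℤ) ^ a) • y ∈ localizedAt p (O₁.map (unitsConj (u p) : B →ₗ[ℤ] B)) :=
    fun p hp => exists_pow_smul_mem_localizedAt_of_fg (Nat.prime_of_mem_primeFactors hp)
      (hO₁.isFullLattice.map_unitsConj (u p)) hO₁.isFullLattice.1
  choose! a ha using key
  refine ⟨N.primeFactors.sup a, fun y hy => ⟨⟨0, ?_⟩, fun p hp => ?_⟩⟩
  · rw [pow_zero, one_smul]
    exact O₁.smul_mem _ hy
  · obtain ⟨m, hm⟩ : p ^ a p ∣ N ^ N.primeFactors.sup a :=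
      (pow_dvd_pow p (Finset.le_sup hp)).trans
        (pow_dvd_pow_of_dvd (Nat.dvd_of_mem_primeFactors hp) _)
    have h : ((N : ℤ) ^ N.primeFactors.sup a) = (m : ℤ) * (p : ℤ) ^ a p := by
      rw [mul_comm]
      exact_mod_cast hm
    rw [h, mul_smul]
    exact Submodule.smul_mem _ _ (ha p hp y hy)

/-- `O₂` is contained in `N^{-b} O₁` for a suitable `b`. [folklore] -/
theorem exists_pow_smul_eichlerConj_mem (hO₁ : IsZOrder O₁) (hN : N ≠ 0) :
    ∃ b : ℕ, ∀ x ∈ eichlerConj O₁ N u, ((N : ℤ) ^ b) • x ∈ O₁ := by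
  classical
  have key : ∀ p ∈ N.primeFactors, ∃ b : ℕ, ∀ y ∈ O₁.map (unitsConj (u p) : B →ₗ[ℤ] B),
      ((p : ℤ) ^ b) • y ∈ localizedAt p O₁ :=
    fun p hp => exists_pow_smul_mem_localizedAt_of_fg (Nat.prime_of_mem_primeFactors hp)
      hO₁.isFullLattice (hO₁.isFullLattice.1.map _)
  choose! b hb using key
  refine ⟨N.primeFactors.sup b, fun x hx => ?_⟩
  refine mem_of_forall_prime_mem_localizedAt fun ℓ hℓ => ?_
  by_cases hℓN : ℓ ∣ N
  · have hℓm : ℓ ∈ N.primeFactors := Nat.mem_primeFactors.mpr ⟨hℓ, hℓN, hN⟩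
    obtain ⟨t, ht, htx⟩ := hx.2 ℓ hℓm
    have h1 : ((ℓ : ℤ) ^ b ℓ) • x ∈ localizedAt ℓ O₁ := by
      refine mem_localizedAt_of_smul_mem ht ?_
      rw [smul_comm]
      exact hb ℓ hℓm _ htx
    obtain ⟨m, hm⟩ : ℓ ^ b ℓ ∣ N ^ N.primeFactors.sup b :=
      (pow_dvd_pow ℓ (Finset.le_sup hℓm)).trans (pow_dvd_pow_of_dvd hℓN _)
    have h : ((N : ℤ) ^ N.primeFactors.sup b) = (m : ℤ) * (ℓ : ℤ) ^ b ℓ := by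
      rw [mul_comm]
      exact_mod_cast hm
    rw [h, mul_smul]
    exact Submodule.smul_mem _ _ h1
  · obtain ⟨k, hk⟩ := hx.1
    refine mem_localizedAt_of_coprime_smul_mem (isCoprime_pow_of_not_dvd hℓ hℓN k) ?_
    rw [smul_comm]
    exact O₁.smul_mem _ hk

/-- **The localisation of `O₂` at a prime `q ∤ N` is `O₁,(q)`.** [cite: VignerasLNM800, Ch. III §5 Prop. 5.1] -/
theorem localizedAt_eichlerConj_of_not_dvd (hO₁ : IsZOrder O₁) {q : ℕ} (hq : q.Prime)
    (hqN : ¬ q ∣ N) : localizedAt q (eichlerConj O₁ N u) = localizedAt q O₁ := by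
  refine le_antisymm (localizedAt_le_localizedAt_of_le fun x hx => ?_)
    (localizedAt_le_localizedAt_of_le fun y hy => ?_)
  · obtain ⟨k, hk⟩ := hx.1
    exact mem_localizedAt_of_coprime_smul_mem (isCoprime_pow_of_not_dvd hq hqN k) hk
  · obtain ⟨a, ha⟩ := exists_pow_smul_mem_eichlerConj hO₁ (N := N) (u := u)
    exact mem_localizedAt_of_coprime_smul_mem (isCoprime_pow_of_not_dvd hq hqN a) (ha y hy)

/-- **The localisation of `O₂` at a prime `p ∣ N` is `(u_p O₁ u_p⁻¹)_(p)`** (Vignéras III §5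
Prop. 5.1, surjectivity: "`Y` est dense dans `Z_p`, donc `Y_p = Z_p`" — here: every element of
`u_p O₁ u_p⁻¹` has a prime-to-`p` multiple in `O₂`). [cite: VignerasLNM800, Ch. III §5 Prop. 5.1] -/
theorem localizedAt_eichlerConj_of_mem (hO₁ : IsZOrder O₁) (hN : N ≠ 0) {p : ℕ}
    (hp : p ∈ N.primeFactors) :
    localizedAt p (eichlerConj O₁ N u) =
      localizedAt p (O₁.map (unitsConj (u p) : B →ₗ[ℤ] B)) := by
  have hpp : p.Prime := Nat.prime_of_mem_primeFactors hp
  refine le_antisymm (localizedAt_le_localizedAt_of_le fun x hx => hx.2 p hp)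
    (localizedAt_le_localizedAt_of_le fun y hy => ?_)
  obtain ⟨a, ha⟩ := exists_pow_smul_mem_eichlerConj hO₁ (N := N) (u := u)
  obtain ⟨n, hn, hny⟩ := hO₁.isFullLattice.2 y
  have hT : ((N : ℤ) ^ a * n) • y ∈ eichlerConj O₁ N u := by
    rw [mul_smul]
    exact ha _ hny
  have hT0 : ((N : ℤ) ^ a * n) ≠ 0 := mul_ne_zero (pow_ne_zero _ (Nat.cast_ne_zero.mpr hN)) hn
  obtain ⟨e, s, hs, hse⟩ := exists_isCoprime_mul_pow_eq hpp hT0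
  rw [← hse] at hT
  refine ⟨s, hs, ⟨?_, fun q hq => ?_⟩⟩
  · obtain ⟨k, hk⟩ := hT.1
    obtain ⟨m, hm⟩ : p ^ e ∣ N ^ e := pow_dvd_pow_of_dvd (Nat.dvd_of_mem_primeFactors hp) e
    refine ⟨k + e, ?_⟩
    have h : ((N : ℤ) ^ (k + e)) • (s • y) = (m : ℤ) • (((N : ℤ) ^ k) • ((s * (p : ℤ) ^ e) • y)) := by
      rw [smul_smul, smul_smul, smul_smul, pow_add]
      congr 1
      have hm' : ((N : ℤ) ^ e) = (p : ℤ) ^ e * m := by exact_mod_cast hm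
      rw [hm']
      ring
    rw [h]
    exact O₁.smul_mem _ hk
  · by_cases hqp : q = p
    · subst hqp
      exact le_localizedAt _ (Submodule.smul_mem _ _ hy)
    · have hcop : IsCoprime (q : ℤ) ((p : ℤ) ^ e) := by
        refine IsCoprime.pow_right ?_
        rw [Nat.isCoprime_iff_coprime]
        exact (Nat.coprime_primes (Nat.prime_of_mem_primeFactors hq) hpp).mpr hqp
      refine mem_localizedAt_of_smul_mem hcop ?_
      rw [smul_smul, mul_comm]
      exact hT.2 q hq

/-- `O₁ ∩ O₂ = {x ∈ O₁ | x ∈ (u_p O₁ u_p⁻¹)_(p) for all p ∣ N}`. [folklore] -/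
theorem mem_inf_eichlerConj_iff {x : B} :
    x ∈ O₁ ⊓ eichlerConj O₁ N u ↔
      x ∈ O₁ ∧ ∀ p ∈ N.primeFactors, x ∈ localizedAt p (O₁.map (unitsConj (u p) : B →ₗ[ℤ] B)) := by
  simp only [Submodule.mem_inf, mem_eichlerConj_iff]
  constructor
  · rintro ⟨hx, -, h⟩
    exact ⟨hx, h⟩
  · rintro ⟨hx, h⟩
    exact ⟨hx, ⟨0, by rwa [pow_zero, one_smul]⟩, h⟩

variable [Algebra ℚ B]

/-- **`O₂` is a `ℤ`-order** (Vignéras III §5, local property (1): `O₂` is locally an order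
everywhere; directly: `N^a O₁ ⊆ O₂ ⊆ N^{-b} O₁`, and `O₂` is a ring as an intersection of
rings). [cite: VignerasLNM800, Ch. III §5 Prop. 5.1 and propriété locale (1)] -/
theorem isZOrder_eichlerConj (hO₁ : IsZOrder O₁) (hN : N ≠ 0) :
    IsZOrder (eichlerConj O₁ N u) where
  one_mem := ⟨⟨0, by rw [pow_zero, one_smul]; exact hO₁.one_mem⟩,
    fun p _ => le_localizedAt _ (hO₁.map_unitsConj (u p)).one_mem⟩
  mul_mem := by
    rintro a ⟨⟨k, hka⟩, ha⟩ b ⟨⟨l, hlb⟩, hb⟩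
    refine ⟨⟨k + l, ?_⟩,
      fun p hp => mul_mem_localizedAt (hO₁.map_unitsConj (u p)).mul_mem (ha p hp) (hb p hp)⟩
    rw [pow_add, ← smul_mul_smul_comm]
    exact hO₁.mul_mem _ hka _ hlb
  isFullLattice := by
    obtain ⟨a, ha⟩ := exists_pow_smul_mem_eichlerConj hO₁ (N := N) (u := u)
    obtain ⟨b, hb⟩ := exists_pow_smul_eichlerConj_mem hO₁ hN (u := u)
    refine ⟨fg_of_smul_mem hO₁.isFullLattice.1 (pow_ne_zero b (Nat.cast_ne_zero.mpr hN)) hb,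
      fun d => ?_⟩
    obtain ⟨n, hn, hnd⟩ := hO₁.isFullLattice.2 d
    refine ⟨(N : ℤ) ^ a * n, mul_ne_zero (pow_ne_zero _ (Nat.cast_ne_zero.mpr hN)) hn, ?_⟩
    rw [mul_smul]
    exact ha _ hnd

/-- **`O₂` is a maximal order** when `O₁` is (Vignéras III §5, local property (2), read
backwards: an order `O' ⊇ O₂` has `O'_(ℓ) ⊇ O₂,(ℓ)`, a localisation of a maximal order — `O₁`
or its conjugate `u_ℓ O₁ u_ℓ⁻¹` — hence `O'_(ℓ) = O₂,(ℓ)` for every prime `ℓ`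
(`IsMaximalZOrder.localizedAt_eq_of_le`), and `O' ⊆ ⋂_ℓ O'_(ℓ) = ⋂_ℓ O₂,(ℓ) = O₂`). [cite: VignerasLNM800, Ch. III §5 Prop. 5.1 and propriété locale (2)] -/
theorem isMaximalZOrder_eichlerConj (hO₁ : IsMaximalZOrder O₁) (hN : N ≠ 0) :
    IsMaximalZOrder (eichlerConj O₁ N u) := by
  refine ⟨isZOrder_eichlerConj hO₁.1 hN, fun O' hO' hle => ?_⟩
  refine le_antisymm (fun x hx => ?_) hle
  refine mem_of_forall_prime_mem_localizedAt fun ℓ hℓ => ?_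
  have hxℓ : x ∈ localizedAt ℓ O' := le_localizedAt _ hx
  by_cases hℓN : ℓ ∣ N
  · have hmem : ℓ ∈ N.primeFactors := Nat.mem_primeFactors.mpr ⟨hℓ, hℓN, hN⟩
    have h1 := localizedAt_eichlerConj_of_mem hO₁.1 hN hmem (u := u)
    have h2 : localizedAt ℓ (O₁.map (unitsConj (u ℓ) : B →ₗ[ℤ] B)) ≤ localizedAt ℓ O' :=
      h1 ▸ localizedAt_mono hle
    rw [h1, ← (hO₁.map_unitsConj (u ℓ)).localizedAt_eq_of_le hℓ hO' h2]
    exact hxℓ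
  · have h1 := localizedAt_eichlerConj_of_not_dvd hO₁.1 hℓ hℓN (u := u)
    have h2 : localizedAt ℓ O₁ ≤ localizedAt ℓ O' := h1 ▸ localizedAt_mono hle
    rw [h1, ← hO₁.localizedAt_eq_of_le hℓ hO' h2]
    exact hxℓ

end EichlerConj

/-! ### The index `[O₁ : O₁ ∩ O₂] = N` (Chinese remainder theorem) -/

section Index

variable {B : Type*} [Ring B] {O₁ : Submodule ℤ B} {N : ℕ} {u : ℕ → Bˣ}

/-- **Chinese remainder multipliers**: for `p ∣ N` there is `e ∈ ℕ` with `e ≡ 1 (mod p^{v_p N})`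
and `e ≡ 0 (mod q^{v_q N})` for every other prime `q ∣ N`. [folklore] -/
theorem exists_crt_multiplier (hN : N ≠ 0) {p : ℕ} (hp : p ∈ N.primeFactors) :
    ∃ e : ℕ, (e : ZMod (p ^ N.factorization p)) = 1 ∧
      ∀ q ∈ N.primeFactors, q ≠ p → (e : ZMod (q ^ N.factorization q)) = 0 := by
  have hpp : p.Prime := Nat.prime_of_mem_primeFactors hp
  set Q := N / p ^ N.factorization p with hQ
  have hcop : Nat.Coprime Q (p ^ N.factorization p) :=
    (Nat.Coprime.pow_left _ (Nat.coprime_ordCompl hpp hN)).symm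
  haveI : NeZero (p ^ N.factorization p) := ⟨pow_ne_zero _ hpp.ne_zero⟩
  refine ⟨((Q : ZMod (p ^ N.factorization p))⁻¹).val * Q, ?_, fun q hq hqp => ?_⟩
  · rw [Nat.cast_mul, ZMod.natCast_zmod_val, mul_comm, ZMod.coe_mul_inv_eq_one Q hcop]
  · rw [ZMod.natCast_eq_zero_iff]
    refine Dvd.dvd.mul_left ?_ _
    have hq' : Q.factorization q = N.factorization q := by
      rw [hQ, Nat.factorization_ordCompl, Finsupp.erase_ne hqp]
    rw [← hq']
    exact Nat.ordProj_dvd Q q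

/-- **The index of `O₁ ∩ O₂` in `O₁` is `N`** as soon as, for every `p ∣ N`, the lattice
`O₁ ∩ (u_p O₁ u_p⁻¹)_(p)` is the kernel of a surjective additive map `λ_p : O₁ → ℤ/p^{v_p(N)}`
(then `x ↦ (λ_p x)_p` is onto `∏_p ℤ/p^{v_p(N)}` by the Chinese remainder theorem, with kernel
`O₁ ∩ O₂`). Locally this is Vignéras' "`[M(2,R) : (R R; p^n R R)] = p^n`" (II §2, §4). [cite: VignerasLNM800, Ch. II §2 (ordre d'Eichler de niveau p^n)] -/
theorem relIndex_inf_eichlerConj (hN : N ≠ 0)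
    (lam : (p : ℕ) → (O₁ →+ ZMod (p ^ N.factorization p)))
    (hsurj : ∀ p ∈ N.primeFactors, Function.Surjective (lam p))
    (hker : ∀ p ∈ N.primeFactors, ∀ x : O₁,
      lam p x = 0 ↔ (x : B) ∈ localizedAt p (O₁.map (unitsConj (u p) : B →ₗ[ℤ] B))) :
    (O₁ ⊓ eichlerConj O₁ N u).toAddSubgroup.relIndex O₁.toAddSubgroup = N := by
  classical
  let Λ : O₁ →+ ((p : N.primeFactors) → ZMod ((p : ℕ) ^ N.factorization p)) :=
    { toFun := fun x p => lam p x
      map_zero' := by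
        funext p
        exact map_zero _
      map_add' := fun x y => by
        funext p
        exact map_add _ _ _ }
  have hΛ : ∀ (x : O₁) (p : N.primeFactors), Λ x p = lam p x := fun _ _ => rfl
  have hkerΛ : Λ.ker =
      (O₁ ⊓ eichlerConj O₁ N u).toAddSubgroup.addSubgroupOf O₁.toAddSubgroup := by
    ext x
    rw [AddMonoidHom.mem_ker, AddSubgroup.mem_addSubgroupOf]
    change Λ x = 0 ↔ (x : B) ∈ O₁ ⊓ eichlerConj O₁ N u
    rw [mem_inf_eichlerConj_iff]
    constructor
    · intro h
      exact ⟨x.2, fun p hp => (hker p hp x).mp (by rw [← hΛ x ⟨p, hp⟩, h]; rfl)⟩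
    · rintro ⟨-, h⟩
      funext p
      rw [hΛ]
      exact (hker p p.2 x).mpr (h p p.2)
  have hsurjΛ : Function.Surjective Λ := by
    intro t
    have hx : ∀ p : N.primeFactors, ∃ x : O₁, lam p x = t p := fun p => hsurj p p.2 (t p)
    choose xs hxs using hx
    have he := fun p : N.primeFactors => exists_crt_multiplier hN p.2
    choose e he1 he0 using he
    refine ⟨∑ q : N.primeFactors, (e q : ℤ) • xs q, ?_⟩
    funext p
    rw [hΛ, map_sum, Finset.sum_eq_single p]
    · rw [map_zsmul, hxs, zsmul_eq_mul, Int.cast_natCast, he1, one_mul]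
    · intro q _ hqp
      rw [map_zsmul, zsmul_eq_mul, Int.cast_natCast,
        he0 q p p.2 (fun h => hqp (Subtype.ext h).symm), zero_mul]
    · intro h
      exact absurd (Finset.mem_univ p) h
  rw [AddSubgroup.relIndex, ← hkerΛ, AddSubgroup.index_ker,
    AddMonoidHom.range_eq_top_of_surjective _ hsurjΛ, AddSubgroup.card_top, Nat.card_pi]
  simp only [Nat.card_zmod]
  rw [Finset.prod_coe_sort (f := fun p => p ^ N.factorization p)]
  conv_rhs => rw [← Nat.prod_factorization_pow_eq_self hN]
  rw [Finsupp.prod, Nat.support_factorization]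

end Index

/-! ### From a reduction `ψ : O₁ → M₂(ℤ/p^k)` to the unit `u_p` and the map `λ_p` -/

section FromModPow

variable {B : Type*} [Ring B] [Algebra ℚ B] [IsQuaternionAlgebra ℚ B]

/-- **The unit trick** (Vignéras I §1, `w² = t(w) w - n(w)`, with I §4 Lemme 4.1: `t(w)`,
`n(w) ∈ ℤ` on an order): for `w` in a `ℤ`-order `O` and `p ∈ ℤ`,
`(1 + p w) (1 + p (t - w)) = (1 + p t + p² n₀) · 1` with `t = trd w`, `n₀ = nrd w`, so `1 + p w`
has an inverse in `O_(p)` — stated as: there are `w' ∈ O` and `s ∈ ℤ` coprime to `p` with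
`(1 + p w) w' = s · 1`. [cite: VignerasLNM800, Ch. I §1 Lemme 1.1 and Ch. I §4 Lemme 4.1] -/
theorem exists_one_add_smul_mul_eq_smul_one {O : Submodule ℤ B} (hO : IsZOrder O) {w : B}
    (hw : w ∈ O) (p : ℤ) :
    ∃ w' ∈ O, ∃ s : ℤ, (1 + p • w) * w' = s • (1 : B) ∧ IsCoprime p s := by
  obtain ⟨t, n₀, ht, hn⟩ := Brandt.IsOrder.exists_int_reducedTrace_reducedNorm
    (⟨hO.one_mem, hO.mul_mem, hO.isFullLattice⟩ : Brandt.IsOrder B O) hw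
  have hww : w * w = t • w - n₀ • (1 : B) := by
    rw [mul_self_eq_reducedTrace_mul_sub_reducedNorm ℚ B w, ht, hn, Algebra.algebraMap_eq_smul_one,
      Algebra.algebraMap_eq_smul_one, smul_mul_assoc, one_mul, Int.cast_smul_eq_zsmul,
      Int.cast_smul_eq_zsmul]
  refine ⟨1 + p • (t • (1 : B) - w), ?_, 1 + p * (t + p * n₀), ?_, ?_⟩
  · exact O.add_mem hO.one_mem (O.smul_mem _ (O.sub_mem (O.smul_mem _ hO.one_mem) hw))
  · have hexp : (1 + p • w) * (1 + p • (t • (1 : B) - w)) =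
        1 + p • (t • (1 : B) - w) + p • w + p • w * (p • (t • (1 : B) - w)) := by
      rw [mul_add, mul_one, add_mul, one_mul]
      abel
    have hprod : p • w * (p • (t • (1 : B) - w)) = (p ^ 2 * n₀) • (1 : B) := by
      rw [smul_mul_smul_comm, mul_sub, mul_smul_comm, mul_one, hww]
      module
    rw [hexp, hprod]
    module
  · exact isCoprime_one_right.add_mul_left_right _

/-- **From a reduction modulo `p^k` to the local Eichler datum at `p`** (Vignéras II §2: the
Eichler order of level `p^n` is `M(2,R) ∩ g M(2,R) g⁻¹ = (R R; p^n R R)`, `g = diag(1, p^n)`,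
of index `p^n`). Let `O₁` be a `ℤ`-order in a division quaternion algebra over `ℚ` and
`ψ : O₁ → M₂(ℤ/p^k)` a surjective ring homomorphism with kernel `p^k O₁` (given as a function on
`B` with these properties on `O₁`), `n < k`. Then for `u = ψ⁻¹(diag(1, p^n)) ∈ O₁` (a unit of
`B`) the lattice `O₁ ∩ (u O₁ u⁻¹)_(p)` is the kernel of the surjective additive map
`λ : O₁ → ℤ/p^n`, `x ↦ ψ(x)₂₁ mod p^n`. (The point `p^n ∈ u O₁,(p)` uses `u u' = p^n (1 + p w)`
for `u' = ψ⁻¹(diag(p^n, 1))` and `exists_one_add_smul_mul_eq_smul_one`.) [cite: VignerasLNM800, Ch. II §2 (ordre d'Eichler de niveau p^n) and Lemme 2.4] -/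
theorem exists_unitsConj_kernel_of_modPow (hdiv : ∀ x : B, x ≠ 0 → IsUnit x)
    {O₁ : Submodule ℤ B} (hO₁ : IsZOrder O₁) {p : ℕ} (hp : p.Prime) {n k : ℕ} (hnk : n < k)
    (ψ : B → Matrix (Fin 2) (Fin 2) (ZMod (p ^ k)))
    (hadd : ∀ x ∈ O₁, ∀ y ∈ O₁, ψ (x + y) = ψ x + ψ y)
    (hmul : ∀ x ∈ O₁, ∀ y ∈ O₁, ψ (x * y) = ψ x * ψ y) (hone : ψ 1 = 1)
    (hsurj : ∀ m, ∃ x ∈ O₁, ψ x = m)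
    (hker : ∀ x ∈ O₁, ψ x = 0 ↔ ∃ y ∈ O₁, x = ((p : ℤ) ^ k) • y) :
    ∃ (u : Bˣ) (lam : O₁ →+ ZMod (p ^ n)), (u : B) ∈ O₁ ∧ Function.Surjective lam ∧
      ∀ x : O₁, lam x = 0 ↔ (x : B) ∈ localizedAt p (O₁.map (unitsConj u : B →ₗ[ℤ] B)) := by
  haveI : NeZero (p ^ k) := ⟨pow_ne_zero _ hp.ne_zero⟩
  haveI : NeZero (p ^ n) := ⟨pow_ne_zero _ hp.ne_zero⟩
  haveI : IsAddTorsionFree B := isAddTorsionFree_of_charZero_module ℚ B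
  haveI : Nontrivial B := Module.nontrivial_of_finrank_pos (R := ℚ)
    (by rw [IsQuaternionAlgebra.finrank_eq_four (K := ℚ) (D := B)]; norm_num)
  -- `ψ` restricted to `O₁` is an additive homomorphism
  let ψO : O₁ →+ Matrix (Fin 2) (Fin 2) (ZMod (p ^ k)) :=
    AddMonoidHom.mk' (fun x => ψ x) fun x y => hadd x x.2 y y.2
  have hψO : ∀ x : O₁, ψO x = ψ x := fun _ => rfl
  have hzsmul : ∀ (m : ℤ) (x : B), x ∈ O₁ → ψ (m • x) = m • ψ x := fun m x hx => by
    have h := map_zsmul ψO m ⟨x, hx⟩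
    rwa [hψO, hψO] at h
  have hsub : ∀ x ∈ O₁, ∀ y ∈ O₁, ψ (x - y) = ψ x - ψ y := fun x hx y hy => by
    have h := map_sub ψO ⟨x, hx⟩ ⟨y, hy⟩
    rwa [hψO, hψO, hψO] at h
  -- the elements `u = ψ⁻¹ diag(1, p^n)` and `u' = ψ⁻¹ diag(p^n, 1)`
  set q : ZMod (p ^ k) := (p : ZMod (p ^ k)) ^ n with hq
  obtain ⟨u, huO, hu⟩ := hsurj !![1, 0; 0, q]
  obtain ⟨u', hu'O, hu'⟩ := hsurj !![q, 0; 0, 1]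
  have h0 : ψ (u * u' - ((p : ℤ) ^ n) • 1) = 0 := by
    rw [hsub _ (hO₁.mul_mem _ huO _ hu'O) _ (O₁.smul_mem _ hO₁.one_mem), hmul _ huO _ hu'O, hu,
      hu', hzsmul _ _ hO₁.one_mem, hone, Matrix.mul_fin_two, sub_eq_zero]
    ext i j
    fin_cases i <;> fin_cases j <;> simp [hq]
  obtain ⟨z₀, hz₀O, hz₀⟩ :=
    (hker _ (O₁.sub_mem (hO₁.mul_mem _ huO _ hu'O) (O₁.smul_mem _ hO₁.one_mem))).mp h0
  set w : B := ((p : ℤ) ^ (k - n - 1)) • z₀ with hw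
  have hwO : w ∈ O₁ := O₁.smul_mem _ hz₀O
  have huu' : u * u' = ((p : ℤ) ^ n) • (1 + (p : ℤ) • w) := by
    have h1 : u * u' = ((p : ℤ) ^ n) • 1 + ((p : ℤ) ^ k) • z₀ := by
      rw [← hz₀]
      abel
    have hk' : (p : ℤ) ^ n * (p : ℤ) * (p : ℤ) ^ (k - n - 1) = (p : ℤ) ^ k := by
      rw [← pow_succ, ← pow_add]
      congr 1
      omega
    rw [h1, smul_add, hw, smul_smul, smul_smul, hk']
  obtain ⟨w', hw'O, s, hs, hps⟩ := exists_one_add_smul_mul_eq_smul_one hO₁ hwO (p : ℤ)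
  have hum : u * (u' * w') = ((p : ℤ) ^ n * s) • (1 : B) := by
    rw [← mul_assoc, huu', smul_mul_assoc, hs, smul_smul]
  have hpns : ((p : ℤ) ^ n * s) ≠ 0 := by
    refine mul_ne_zero (pow_ne_zero _ (Nat.cast_ne_zero.mpr hp.ne_zero)) fun hs0 => ?_
    rw [hs0, isCoprime_zero_right, Int.isUnit_iff_natAbs_eq, Int.natAbs_natCast] at hps
    exact hp.ne_one hps
  have hu0 : u ≠ 0 := by
    intro h
    rw [h, zero_mul] at hum
    exact one_ne_zero ((smul_eq_zero_iff_right hpns).mp hum.symm)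
  obtain ⟨uU, huU⟩ := hdiv u hu0
  -- the map `λ`
  have hdvd : p ^ n ∣ p ^ k := pow_dvd_pow p hnk.le
  let lam : O₁ →+ ZMod (p ^ n) :=
    AddMonoidHom.mk' (fun x => ZMod.castHom hdvd (ZMod (p ^ n)) (ψ x 1 0)) fun x y => by
      change ZMod.castHom hdvd (ZMod (p ^ n)) (ψ ((x : B) + y) 1 0) =
        ZMod.castHom hdvd (ZMod (p ^ n)) (ψ x 1 0) + ZMod.castHom hdvd (ZMod (p ^ n)) (ψ y 1 0)
      rw [hadd x x.2 y y.2, Matrix.add_apply, map_add]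
  have hlam : ∀ x : O₁, lam x = ZMod.castHom hdvd (ZMod (p ^ n)) (ψ x 1 0) := fun _ => rfl
  have hcastq : ZMod.castHom hdvd (ZMod (p ^ n)) q = 0 := by
    rw [hq, map_pow, map_natCast, ← Nat.cast_pow, ZMod.natCast_self]
  refine ⟨uU, lam, huU ▸ huO, fun t => ?_, fun x => ?_⟩
  · -- surjectivity
    obtain ⟨t', ht'⟩ := ZMod.castHom_surjective hdvd t
    obtain ⟨x, hxO, hx⟩ := hsurj !![0, 0; t', 0]
    refine ⟨⟨x, hxO⟩, ?_⟩
    rw [hlam]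
    change ZMod.castHom hdvd (ZMod (p ^ n)) (ψ x 1 0) = t
    rw [hx]
    simpa using ht'
  · -- the kernel
    have hxO : (x : B) ∈ O₁ := x.2
    rw [hlam, mem_localizedAt_iff]
    constructor
    · intro hc
      obtain ⟨c', hc'⟩ : ∃ c' : ZMod (p ^ k), ψ x 1 0 = q * c' := by
        have hval : (p ^ n) ∣ (ψ x 1 0).val := by
          rw [← ZMod.natCast_eq_zero_iff, ← map_natCast (ZMod.castHom hdvd (ZMod (p ^ n))),
            ZMod.natCast_zmod_val]
          exact hc
        obtain ⟨m, hm⟩ := hval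
        refine ⟨m, ?_⟩
        rw [← ZMod.natCast_zmod_val (ψ x 1 0), hm, Nat.cast_mul, Nat.cast_pow, hq]
      obtain ⟨w₁, hw₁O, hw₁⟩ := hsurj !![ψ x 0 0, q * ψ x 0 1; c', ψ x 1 1]
      have hmat : ψ x * ψ u = ψ u * ψ w₁ := by
        rw [hu, hw₁]
        ext i j
        fin_cases i <;> fin_cases j <;>
          simp [Matrix.mul_apply, Fin.sum_univ_two, hc', mul_comm]
      have h0' : ψ (x * u - u * w₁) = 0 := by
        rw [hsub _ (hO₁.mul_mem _ hxO _ huO) _ (hO₁.mul_mem _ huO _ hw₁O), hmul _ hxO _ huO,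
          hmul _ huO _ hw₁O, hmat, sub_self]
      obtain ⟨z, hzO, hz⟩ :=
        (hker _ (O₁.sub_mem (hO₁.mul_mem _ hxO _ huO) (hO₁.mul_mem _ huO _ hw₁O))).mp h0'
      refine ⟨s, hps, ?_⟩
      rw [mem_map_unitsConj_iff]
      have hxu : (x : B) * u = u * w₁ + ((p : ℤ) ^ k) • z := by
        rw [← hz]
        abel
      have hk : ((p : ℤ) ^ (k - n)) * ((p : ℤ) ^ n * s) = s * (p : ℤ) ^ k := by
        rw [← mul_assoc, ← pow_add, Nat.sub_add_cancel hnk.le]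
        ring
      have key : ↑uU⁻¹ * (s • (x : B)) * ↑uU = s • w₁ + ((p : ℤ) ^ (k - n)) • (u' * w' * z) := by
        have lhs : (uU : B) * (↑uU⁻¹ * (s • (x : B)) * ↑uU) = s • ((x : B) * u) := by
          rw [← mul_assoc, ← mul_assoc, Units.mul_inv, one_mul, smul_mul_assoc, huU]
        rw [← Units.mul_right_inj uU, lhs, hxu, huU, smul_add, smul_smul, mul_add, mul_smul_comm,
          mul_smul_comm, show u * (u' * w' * z) = (u * (u' * w')) * z by simp only [mul_assoc], hum,
          smul_mul_assoc, one_mul, smul_smul, hk]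
      rw [key]
      exact O₁.add_mem (O₁.smul_mem _ hw₁O)
        (O₁.smul_mem _ (hO₁.mul_mem _ (hO₁.mul_mem _ hu'O _ hw'O) _ hzO))
    · rintro ⟨s₁, hs₁, hmem⟩
      rw [mem_map_unitsConj_iff] at hmem
      set w₁ := ↑uU⁻¹ * (s₁ • (x : B)) * ↑uU with hw₁
      have hw₁' : u * w₁ = (s₁ • (x : B)) * u := by
        rw [hw₁, ← huU, ← mul_assoc, ← mul_assoc, Units.mul_inv, one_mul]
      have h1 : ψ u * ψ w₁ = s₁ • (ψ x * ψ u) := by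
        rw [← hmul _ huO _ hmem, hw₁', hmul _ (O₁.smul_mem _ hxO) _ huO, hzsmul _ _ hxO,
          smul_mul_assoc]
      have h2 := congrFun (congrFun h1 1) 0
      rw [hu] at h2
      simp [Matrix.mul_apply, Fin.sum_univ_two] at h2
      -- `h2 : q * ψ w₁ 1 0 = s₁ • ψ x 1 0`
      have h3 := congrArg (ZMod.castHom hdvd (ZMod (p ^ n))) h2
      rw [map_mul, hcastq, zero_mul, map_mul, map_intCast] at h3
      have hunit : IsUnit ((s₁ : ℤ) : ZMod (p ^ n)) := by
        rw [ZMod.coe_int_isUnit_iff_isCoprime, Nat.cast_pow]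
        exact hs₁.pow_left
      exact (hunit.mul_right_eq_zero).mp h3.symm

end FromModPow

/-! ### Assembly: an Eichler order of level `N` inside a maximal order with reductions `ψ_p` -/

section Assembly

variable {B : Type*} [Ring B] [Algebra ℚ B] [IsQuaternionAlgebra ℚ B]

/-- **A maximal order with reductions modulo `p^{v_p(N)+1}` for all `p ∣ N` has a companion
maximal order `O₂` with `[O₁ : O₁ ∩ O₂] = N`** (Vignéras III §5: Eichler orders of level `N`
from the local Eichler orders of level `p^{v_p N}`, II §2, by the local–global correspondence
Prop. 5.1). Here `B` is a division quaternion algebra over `ℚ`, `O₁` a maximal `ℤ`-order, and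
for each prime `p ∣ N` we are given a surjective ring homomorphism `ψ_p : O₁ → M₂(ℤ/p^{k_p})`,
`k_p = v_p(N) + 1`, with kernel `p^{k_p} O₁` (as a function on `B`). [cite: VignerasLNM800, Ch. III §5 Prop. 5.1 and propriété locale (3), Ch. II §2] -/
theorem exists_isMaximalZOrder_relIndex_eq_of_modPow (hdiv : ∀ x : B, x ≠ 0 → IsUnit x)
    {O₁ : Submodule ℤ B} (hO₁ : IsMaximalZOrder O₁) {N : ℕ} (hN : N ≠ 0)
    (hψ : ∀ p ∈ N.primeFactors,
      ∃ ψ : B → Matrix (Fin 2) (Fin 2) (ZMod (p ^ (N.factorization p + 1))),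
        (∀ x ∈ O₁, ∀ y ∈ O₁, ψ (x + y) = ψ x + ψ y) ∧
        (∀ x ∈ O₁, ∀ y ∈ O₁, ψ (x * y) = ψ x * ψ y) ∧ ψ 1 = 1 ∧
        (∀ m, ∃ x ∈ O₁, ψ x = m) ∧
        (∀ x ∈ O₁, ψ x = 0 ↔ ∃ y ∈ O₁, x = ((p : ℤ) ^ (N.factorization p + 1)) • y)) :
    ∃ O₂ : Submodule ℤ B, IsMaximalZOrder O₂ ∧
      (O₁ ⊓ O₂).toAddSubgroup.relIndex O₁.toAddSubgroup = N := by
  classical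
  have key : ∀ p ∈ N.primeFactors, ∃ (u : Bˣ) (lam : O₁ →+ ZMod (p ^ N.factorization p)),
      (u : B) ∈ O₁ ∧ Function.Surjective lam ∧
      ∀ x : O₁, lam x = 0 ↔ (x : B) ∈ localizedAt p (O₁.map (unitsConj u : B →ₗ[ℤ] B)) := by
    intro p hp
    obtain ⟨ψ, hadd, hmul, hone, hsurj, hker⟩ := hψ p hp
    exact exists_unitsConj_kernel_of_modPow hdiv hO₁.1 (Nat.prime_of_mem_primeFactors hp)
      (Nat.lt_succ_self _) ψ hadd hmul hone hsurj hker
  choose! u lam _hu hsurj hker using key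
  exact ⟨eichlerConj O₁ N u, isMaximalZOrder_eichlerConj hO₁ hN,
    relIndex_inf_eichlerConj hN lam hsurj hker⟩

/-- **Eichler orders of level `N` exist in a maximal order admitting reductions `ψ_p`
(`p ∣ N`)**: with `O₂` as above, `O₁ ∩ O₂` is an Eichler order of level `N`
(`IsEichlerOrder`, `BrandtModule.lean`; Vignéras I §4 Déf. and III §5 Déf. (niveau)). [cite: VignerasLNM800, Ch. III §5 Prop. 5.1 and Déf. (niveau), Ch. II §2] -/
theorem exists_isEichlerOrder_of_modPow (hdiv : ∀ x : B, x ≠ 0 → IsUnit x)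
    {O₁ : Submodule ℤ B} (hO₁ : IsMaximalZOrder O₁) {N : ℕ} (hN : N ≠ 0)
    (hψ : ∀ p ∈ N.primeFactors,
      ∃ ψ : B → Matrix (Fin 2) (Fin 2) (ZMod (p ^ (N.factorization p + 1))),
        (∀ x ∈ O₁, ∀ y ∈ O₁, ψ (x + y) = ψ x + ψ y) ∧
        (∀ x ∈ O₁, ∀ y ∈ O₁, ψ (x * y) = ψ x * ψ y) ∧ ψ 1 = 1 ∧
        (∀ m, ∃ x ∈ O₁, ψ x = m) ∧
        (∀ x ∈ O₁, ψ x = 0 ↔ ∃ y ∈ O₁, x = ((p : ℤ) ^ (N.factorization p + 1)) • y)) :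
    ∃ O : Submodule ℤ B, IsEichlerOrder O N ∧ O ≤ O₁ := by
  obtain ⟨O₂, hO₂, hidx⟩ := exists_isMaximalZOrder_relIndex_eq_of_modPow hdiv hO₁ hN hψ
  exact ⟨O₁ ⊓ O₂, ⟨O₁, O₂, hO₁, hO₂, rfl, hidx⟩, inf_le_left⟩

end Assembly

end Literature.NumberTheory.Automorphic
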